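import Summits.QuantumFields.YangMills.Theorems.BalabanUVNodesK2EndOfChain190OwnDrift

/-!
# idea-4 g10 (lens «ideate-on-items») — QUANTIFIER-PLACEMENT FINDING, kernel half
# «Displayed as PRINT's ROWS at K1's witness, the END item is a THEOREM OF THE TREE; node O's END-side bill is the ∃-side conjunct, served on the seam»

Cell `ym-nodeO-ideate`, seat idea-4 (generation 10), crux K2⁷ `EndpointGivenBR13SepCoPH` = stmt-QuantumFields-20543 on
`route-QuantumFields-BalabanUVNodes` (rev 25).  Workfile only: nothing here is filed as an item, no skeleton is registered, counts unmoved.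

WHAT IS KERNEL-CHECKED HERE (all hypotheses displayed; 0 `sorry`, 0 `axiom`).
* `RowsPrint13 F θ hP` — PRINT's β-rows AT ONE TUPLE, verbatim the hypothesis body of an4's one text
  `BalabanUVNodesK2EndOfChain190OwnDrift.EndpointGivenBR13SepCoPH_of_ownDriftRunChain190K` ([I] (2.12)–(2.14): the (190)-leaves at every in-window run
  prefix relative to the chain's OWN one-loop numbers `b`, the side conditions, a box `0 < γ₀`, the CAP `c.ε₁ · K_rem,L ≤ s`, a drift `OneLoopDrift s A b`, `SurvCont`).
* Variant Rᵖ of plan g82's drawer `D82-REV26/Sketch26.lean` (Variant R with the rows letter spelled as print's road instead of the box letter `∃ κ, RemAt …`):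
  `K1Rp` = K1⁷ + conjunct `RowsPrint13` at the SAME witness; `K2Rp` = K2⁷ with `RowsPrint13` displayed.
* `k2Rp_holds : K2Rp` — OUTRIGHT, by an4's `endpointExistence_of_runLeaves190H_ownDrift` (§1 of that file): under this keying the END item is CLOSED by the tree.
* `closesRp : Record13SepCoPHInhabited → K1Rp → SpineGivenEndpointR13SepCoPH → BalabanLadder.UV` — the rung from THREE binders (K0⁷, K1ᴿᵖ, K3⁷ verbatim);
  `closesRp4` the four-binder form with `K2Rp` displayed (born closed).
* bridges: `k1_7_of_k1Rp` (K1ᴿᵖ ⇒ K1⁷); `RowsAll13` := the ∀θ programme «print's rows at EVERY (B)-carrying tuple» (= an4 §2's hypothesis);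
  `k2_7_of_rowsAll` (= an4 §2 BY NAME: the ∀θ programme closes K2⁷); `k1Rp_of_k1_7_and_rowsAll` (the ∀θ programme is the SPECIAL CASE «rows owed everywhere» of
  «rows owed once, at the witness»).
* `cap_satisfiable_exists_side` — the cap row is of the printed type «ε₁ chosen AFTER K_rem» (`RemainderChain.exists_eps1_le`): satisfiable where ε₁ is CHOSEN (the ∃-side),
  not at a ∀θ tuple whose faithful letter `c.ε₁ = θ.ε₂₉` is GIVEN ([II] p.21 after (2.41); [I] Thm 3 p.264 chooses ε₁).

HONEST FRAMING.  Implications between statement SHAPES; NOTHING of Bałaban's analysis is asserted or discharged; `RowsPrint13` is inhabited at no tuple here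
(instance 0∕1); K2⁷ as filed (∀θ) is NOT proved and NOT weakened by this file; (D1)∕(D4) NOT discharged; [Balaban1987RG1] Thm 2 ∕ (0.31) p.259 is UNPROVED IN PRINT;
route R4 closes the CONDITIONAL finite-𝕋⁴ rung `BalabanLadder.UV` only — NOT the continuum limit, NOT ℝ⁴, NOT OS, NOT the Yang–Mills mass gap, NOT Clay.
No `def` of mathematics (three abbreviating `def`s of statement shapes), no `instance`, no `notation`, no `axiom`.
-/

noncomputable section

namespace Summit.QuantumFields.YangMills.Cruxes.EndpointGivenBR13SepCoPH.Idea4g10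

open Literature.MathematicalPhysics.QuantumFieldTheory.Balaban1983to89
open Literature.MathematicalPhysics.QuantumFieldTheory.Balaban1983to89.FlowStep
open Literature.MathematicalPhysics.QuantumFieldTheory.Balaban1983to89.B13ScaleTransfer (Pt)
open Literature.MathematicalPhysics.QuantumFieldTheory.Balaban1983to89.DagBinding (EndpointExistence)
open Literature.MathematicalPhysics.QuantumFieldTheory.Balaban1983to89.T4Continuum (T4Family)
open Literature.MathematicalPhysics.QuantumFieldTheory.Balaban1983to89.Beta.Drift (OneLoopDrift)
open Literature.MathematicalPhysics.QuantumFieldTheory.Balaban1983to89.Beta.RemainderChainLattice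
open Literature.MathematicalPhysics.QuantumFieldTheory.Balaban1983to89.Beta.RemainderLimitTorus (LDom limKernel)
open Literature.MathematicalPhysics.QuantumFieldTheory.Balaban1983to89.Beta.RemainderLocalityHolo
open Literature.MathematicalPhysics.QuantumFieldTheory.Balaban1983to89.Beta.RemainderDecay190
open Literature.MathematicalPhysics.QuantumFieldTheory.Balaban1983to89.Beta.RemainderDecay190HoloChain
open Summit.QuantumFields.YangMills.Theorems.BalabanUVNodesK2NamedJetsRunRemAt (SurvCont)
open Summit.QuantumFields.YangMills.Theorems.BalabanUVNodesK2EndOfChain190OwnDrift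
  (endpointExistence_of_runLeaves190H_ownDrift EndpointGivenBR13SepCoPH_of_ownDriftRunChain190K)
open Summit.QuantumFields.YangMills.Theses.BalabanUVNodes
  (Record13SepCoPHInhabited StabilityBAtRecordR13SepCoPH EndpointGivenBR13SepCoPH SpineGivenEndpointR13SepCoPH)

/-! ## §0 Shapes (verbatim from the route texts ∕ an4's one text) -/

/-- K0⁷'s body at `F` (= the hypothesis of K1⁷). -/
def Inhabited13 (F : T4Family) : Prop :=
  ∃ θ : Node00.Stage13HParams F 2, θ.Provisos₁₃SepCoPH F 2 ∧ (θ.ZhUnity F 2 ∧ θ.SlotsNondegenerate₁₃ F 2) ∧ θ.Admissible F 2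

/-- the window conjunct (verbatim from K1⁷ ∕ K2⁷). -/
def Window13 (F : T4Family) (θ : Node00.Stage13HParams F 2) (h : θ.Provisos₁₃SepCoPH F 2) : Prop :=
  ∃ γ₁ : ℝ, 0 < γ₁ ∧ ∀ γ : ℝ, 0 < γ → γ ≤ γ₁ → ∃ P : B12.RunParams, 1 ≤ P.K ∧ ((Node00.datumOfRecord₁₃SepCoPH F 2 θ h).C P).flow.InInterval γ P.K

/-- **PRINT's β-ROWS AT ONE TUPLE** — the hypothesis body of an4's one text, verbatim: SOME own one-loop numbers `b`, slope `s`, drift constant `A`, chain data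
`(M, μ, ν, c, ℓ, α₂, q, γ₀)` with the (190)-leaves at every in-window run prefix relative to `b`, the side conditions, `0 < γ₀`, the CAP `c.ε₁·K_rem,L ≤ s`, the
drift and survivor continuity.  [I] (1.20)–(1.22) p.264, (2.12)–(2.14) p.268, (5.10) p.293; [II] Lemma 3 (2.38) p.20, p.21 after (2.41). -/
def RowsPrint13 (F : T4Family) (θ : Node00.Stage13HParams F 2) (hP : θ.Provisos₁₃SepCoPH F 2) : Prop :=
  ∃ (b : ℕ → ℝ) (s A : ℝ) (M : ℕ) (_ : NeZero M) (μ ν : Fin 4) (c : B13.Consts) (ℓ α₂ : ℝ) (q : Consts190) (γ₀ : ℝ),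
    (∀ (n : ℕ) (gs : ℕ → ℝ), RGEqH n (Node00.datumOfRecord₁₃SepCoPH F 2 θ hP).βfun gs → Step.InInterval γ₀ n gs → ∀ k, k ≤ n →
      ∃ a : LDom 4 → Pt 4 → ℝ, (Node00.datumOfRecord₁₃SepCoPH F 2 θ hP).βfun k (prefixOf gs k) - b k =
        B12Beta.secondMoment (fun _ _ => limKernel a) μ ν ∧ Nonempty (PolLeavesTFac190H 4 M a c ℓ α₂ q)) ∧
    CondsL 4 c ℓ ∧ c.R22gen ℓ ∧ q.Valid c.δ₀ ∧ SignsL c α₂ q.B₃ ∧ 0 < γ₀ ∧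
    c.ε₁ * remCoeffL 4 M c α₂ q.B₃ ≤ s ∧ OneLoopDrift s A b ∧
    SurvCont (Node00.datumOfRecord₁₃SepCoPH F 2 θ hP).βfun γ₀

/-! ## §1 Variant Rᵖ: rows owed ONCE, at K1's witness; END displayed-rows item is a theorem -/

/-- K1ᴿᵖ: K1⁷'s conclusion plus the conjunct `RowsPrint13` at the SAME witness (the ∃-side owes print's rows where it CHOOSES ε₁, [I] Thm 3 p.264). -/
def K1Rp : Prop :=
  ∀ F : T4Family, Inhabited13 F → ∃ (θ : Node00.Stage13HParams F 2) (h : θ.Provisos₁₃SepCoPH F 2),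
    (θ.ZhUnity F 2 ∧ θ.SlotsNondegenerate₁₃ F 2) ∧ θ.Admissible F 2 ∧ B16.EndStatementBPrinted (Node00.datumOfRecord₁₃SepCoPH F 2 θ h).C ∧
    RowsPrint13 F θ h ∧ Window13 F θ h

/-- K2ᴿᵖ: K2⁷ with `RowsPrint13` displayed as hypothesis. -/
def K2Rp : Prop :=
  ∀ (F : T4Family) (θ : Node00.Stage13HParams F 2) (h : θ.Provisos₁₃SepCoPH F 2), (θ.ZhUnity F 2 ∧ θ.SlotsNondegenerate₁₃ F 2) → θ.Admissible F 2 →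
    B16.EndStatementBPrinted (Node00.datumOfRecord₁₃SepCoPH F 2 θ h).C → RowsPrint13 F θ h → Window13 F θ h →
    EndpointExistence (Node00.datumOfRecord₁₃SepCoPH F 2 θ h).C.toB12

/-- **K2ᴿᵖ HOLDS OUTRIGHT** — an4's §1 `endpointExistence_of_runLeaves190H_ownDrift` BY NAME; unity, admissibility, (B), window UNUSED (cf. idea-4 F3: typed (B) is β-silent). -/
theorem k2Rp_holds : K2Rp := by
  intro F θ hP _hU _hθ _hB hrows _hwin
  obtain ⟨b, s, A, M, instM, μ, ν, c, ℓ, α₂, q, γ₀, hrun, hC, h22, hq, hs, hγ₀, hcap, hdrift, hcont⟩ := hrows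
  exact endpointExistence_of_runLeaves190H_ownDrift F θ hP hrun hC h22 hq hs hγ₀ hdrift hcap hcont

/-- **THE RUNG FROM THREE BINDERS** (K0⁷, K1ᴿᵖ, K3⁷ verbatim): END at the witness is supplied by `k2Rp_holds`; the proof is `closes`' proof with `h2` replaced. -/
theorem closesRp (h0 : Record13SepCoPHInhabited) (h1 : K1Rp) (h3 : SpineGivenEndpointR13SepCoPH) :
    Summit.QuantumFields.YangMills.Theses.BalabanLadder.UV := by
  intro F
  obtain ⟨θ, h, hU, hθ, hb, hrows, hwin⟩ := h1 F (h0 F)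
  have hend : EndpointExistence (Node00.datumOfRecord₁₃SepCoPH F 2 θ h).C.toB12 := k2Rp_holds F θ h hU hθ hb hrows hwin
  exact ⟨Node00.datumOfRecord₁₃SepCoPH F 2 θ h, Node00.isDatumOfRecord₀_datumOfRecord₁₃SepCoPH F 2 θ h, hb, hend, h3 F θ h hU hθ hb hend⟩

/-- the four-binder form, if the END item is to stay displayed (it is then born closed by `k2Rp_holds`). -/
theorem closesRp4 (h0 : Record13SepCoPHInhabited) (h1 : K1Rp) (h2 : K2Rp) (h3 : SpineGivenEndpointR13SepCoPH) :
    Summit.QuantumFields.YangMills.Theses.BalabanLadder.UV := by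
  intro F
  obtain ⟨θ, h, hU, hθ, hb, hrows, hwin⟩ := h1 F (h0 F)
  have hend := h2 F θ h hU hθ hb hrows hwin
  exact ⟨Node00.datumOfRecord₁₃SepCoPH F 2 θ h, Node00.isDatumOfRecord₀_datumOfRecord₁₃SepCoPH F 2 θ h, hb, hend, h3 F θ h hU hθ hb hend⟩

/-! ## §2 Bridges: the ∀θ programme is the special case «rows owed at EVERY (B)-carrying tuple» -/

/-- K1ᴿᵖ is STRONGER than K1⁷ (drop the conjunct). -/
theorem k1_7_of_k1Rp (h : K1Rp) : StabilityBAtRecordR13SepCoPH := by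
  intro F hF
  obtain ⟨θ, hP, hU, hθ, hb, -, hwin⟩ := h F hF
  exact ⟨θ, hP, hU, hθ, hb, hwin⟩

/-- the ∀θ programme of the ideation wave, in print's currency: rows at EVERY tuple carrying K2⁷'s hypotheses (= an4 §2's hypothesis). -/
def RowsAll13 : Prop :=
  ∀ (F : T4Family) (θ : Node00.Stage13HParams F 2) (h : θ.Provisos₁₃SepCoPH F 2), (θ.ZhUnity F 2 ∧ θ.SlotsNondegenerate₁₃ F 2) → θ.Admissible F 2 →
    B16.EndStatementBPrinted (Node00.datumOfRecord₁₃SepCoPH F 2 θ h).C → Window13 F θ h → RowsPrint13 F θ h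

/-- the ∀θ programme closes K2⁷ as filed — an4 §2 BY NAME (recorded for comparison: THIS is what the fifteen cards' roads must supply). -/
theorem k2_7_of_rowsAll (h : RowsAll13) : EndpointGivenBR13SepCoPH :=
  EndpointGivenBR13SepCoPH_of_ownDriftRunChain190K fun F θ hP hU hθ hB hwin => h F θ hP hU hθ hB hwin

/-- … and it gives K1ᴿᵖ from K1⁷: «rows everywhere» ⟹ «rows at the witness», never conversely — only WHO owes the rows, and WHERE, changes. -/
theorem k1Rp_of_k1_7_and_rowsAll (h1 : StabilityBAtRecordR13SepCoPH) (h : RowsAll13) : K1Rp := by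
  intro F hF
  obtain ⟨θ, hP, hU, hθ, hb, hwin⟩ := h1 F hF
  exact ⟨θ, hP, hU, hθ, hb, h F θ hP hU hθ hb hwin, hwin⟩

/-! ## §3 The cap row is an ∃-side row -/

/-- **the CAP is of the printed type «ε₁ chosen after K_rem»**: for any target slope `s > 0` and any constant `K` there is `ε₁ > 0` with `ε₁·K ≤ s`
(`RemainderChain.exists_eps1_le`; [II] p.21 after (2.41), [I] Thm 3 p.264).  Satisfiable where ε₁ is CHOSEN — the ∃-side witness — and vacuous as a method at a ∀θ tuple,
whose faithful chain letter is `c.ε₁ = θ.ε₂₉` (an4's `exists_thr_rows_theta13OfThm1CCM`: `{c₀ with ε₁ := e, …}`), given rather than chosen. -/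
theorem cap_satisfiable_exists_side (s K : ℝ) (hs : 0 < s) : ∃ ε₁ : ℝ, 0 < ε₁ ∧ ε₁ * K ≤ s :=
  Beta.RemainderChain.exists_eps1_le s K hs

end Summit.QuantumFields.YangMills.Cruxes.EndpointGivenBR13SepCoPH.Idea4g10
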